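/-
Copyright: public-domain mathematics; typed transcription for the H21 Literature library (cell pub-balaban, PAPER SUB-CELL B05 gen 5).

# Bałaban, *Propagators and renormalization transformations for lattice gauge theories. I*,
# Commun. Math. Phys. **95** (1984) 17–40 — the lattice Leibniz rule behind (1.121) and the `O(M₀⁻¹)` local
# commutator bound for the Laplacian part of `K(h)`, with (1.128) for `Δ_w + (local) + (decaying)` kernels

[cite: Balaban1984PropagatorsI]  T. Bałaban, Commun. Math. Phys. 95 (1984) 17–40 (= B5 of the series), p. 37
(PDF page 21), display (1.121); p. 38 (PDF 22), display (1.128).  No new quotation is introduced by this file: the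
transcription of (1.121) is the one certified in the header of `B5Local114` (and, since v1.1, of `B5SmoothPartition`),
`Δ_a hA = (Δ − ∂P∂* + aQ*Q)hA = hΔ_aA − [Σ_{b∈st(·)} (∂h)(b)(∂A)(b) − (Δh)A + S*(∂h)QA − Q*S(∂h)A + P₁(∂h)A]
= hΔ_aA − K(h)A`, and the transcription of (1.128) with its surrounding sentences (the local terms carry the small
factor `O(M₀⁻¹)` only) is the one certified in the header of `B5Commutator128`.

WHAT THIS MODULE IS.  Fifth module of gen 5 (after `B5TorusCover`, `B5TorusPartition`, `B5Commutator128`,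
`B5SmoothPartition`).  `B5Commutator128.Schema` reduces (1.128) to three hypotheses (cell GAPS G-B5-29 (a)–(c)): the
split `Δ_a = kerOp l + kerOp k`, the NORMED LOCAL BOUND `‖[h_z, kerOp l]A‖ ≤ ℓ₁(‖Dg A‖ + ‖A‖)` with `ℓ₁ = O(M₀⁻¹)`
(field `local_norm` — in print the computation (1.121)), and the decay (1.126) of `k`.  `B5SmoothPartition`
supplies the two scalar data (1.121) consumes, `∇h = O(M₀⁻¹)` and `Δh = O(M₀⁻²)`.  THIS FILE converts them into the
OPERATOR bound `local_norm` for the LAPLACIAN SUMMAND of `Δ_a = Δ − ∂P∂* + aQ*Q`, i.e. for the two terms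
`Σ_b (∂h)(b)(∂A)(b) − (Δh)A` of `K(h)A`, on the kernel-operator model of `B5Commutator128`
(`V = EuclideanSpace ℝ ι`, `ι` a finite set of field components over the torus carrier `UT N` by a base map `π`):

§1 (any finite index set, any weight `w : ι → ι → ℝ`).  The weighted graph Laplacian as a kernel operator,
`lapKer w` with `(kerOp (lapKer w) A)_i = Σ_j w_ij (A_j − A_i)` (`lap_apply`); THE COMMUTATOR IDENTITY
`[mulOp a, Δ_w] = kerOp ((a_i − a_j) w_ij)` (`comm_lap_eq`, from `B5Commutator128.comm_mulOp_kerOp` — the diagonal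
correction drops out) and its pointwise LEIBNIZ FORM `([a, Δ_w]A)_i = Σ_j w_ij (a_i − a_j)(A_j − A_i) +
(Σ_j w_ij (a_i − a_j))·A_i` (`comm_lap_apply`) — a `(∂a)(∂A)` term plus multiplication by `−(Δ_w a)_i`, the lattice
form of `Σ_b (∂h)(b)(∂A)(b) − (Δh)A`; the Dirichlet form `dirichlet w A = Σ_i Σ_j w_ij (A_j − A_i)²`; and THE NORMED
BOUND `norm_comm_lap_le`: if `w ≥ 0` has row sums `≤ W`, `|a_i − a_j| ≤ ℓ` on every edge (`w_ij ≠ 0`) and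
`|(Δ_w a)_i| ≤ m`, then `‖[a, Δ_w]A‖ ≤ ℓ√W·√(dirichlet w A) + m‖A‖` (weighted Cauchy–Schwarz on the first term,
`norm_mulOp_le` on the second); `norm_comm_lap_le'` restates it in the shape of `Schema.local_norm`,
`≤ (ℓ√W + m)(‖Dg A‖ + ‖A‖)` for any operator `Dg` with `√(dirichlet w A) ≤ ‖Dg A‖`; `comm_kerOp_add` (commutators
add over `kerOp (l + l′)`).
§2 (the torus).  Axis neighbours `up x μ = x + e_μ`, `dn x μ = x − e_μ` on `UT N`; the INTERFACE `IsAxisLap π w`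
(a Prop: `w ≥ 0`; `w_ij ≠ 0 ⇒ dist(π i, π j) ≤ 1`; row sums `≤ 2d`; and the axis identity
`Σ_j w_ij (f(π j) − f(π i)) = Σ_μ (f(π i + e_μ) − 2f(π i) + f(π i − e_μ))` for every `f : UT N → ℝ` — the shape of
`Δ = Σ_μ ∂_μ*∂_μ` acting componentwise); the centred second-difference bound `abs_hSU_centred_le`
(`|hS_z(x+e_μ) − 2hS_z(x) + hS_z(x−e_μ)| ≤ 52/M₀²`, from `B5SmoothPartition.abs_hS_second_diff_le` rebased at
`x − e_μ`); and THE LAPLACIAN PART OF THE LOCAL BOUND, PROVED: `norm_comm_lap_hS_le`,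
`‖[hS_z, Δ_w]A‖ ≤ (4d/M₀)·√(2d)·√(dirichlet w A) + (52d/M₀²)·‖A‖` for every axis Laplacian `w`, every centre `z`,
every torus with `2M₀ ≤ N_i` (`ℓ = 4d/M₀` by `hSU_lipschitz` and range `≤ 1`; `m = 52d/M₀²` by the axis identity and
`abs_hSU_centred_le`; `W = 2d`), and `local_norm_lap_hS` = the field `Schema.local_norm` for `l := lapKer w` with
`ℓ₁ := (4d/M₀)√(2d) + 52d/M₀² = O(M₀⁻¹)`.
§3 CONSTRUCTION (the interface is inhabited, no existence smuggled): `up_dn`, `dist_up_le`/`dist_dn_le` (axis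
neighbours are at torus distance `≤ 1`), the scalar axis weight `axisW x y = #{μ : y = x + e_μ} + #{μ : y = x − e_μ}`
and `isAxisLap_torus : IsAxisLap id axisW` (scalar fields on the torus, `ι = UT N`); §3b the componentwise weight
`axisWC` on `ι = UT N × κ` (`κ` a finite component index, `π = Prod.fst`, `axisW` between equal components) and
`isAxisLap_prod` (vector-valued fields) — added in v1.1 (additive; v1 = p181334 had the scalar instance only).
§4 (1.128) FOR `Δ_model = kerOp (lapKer w + l′) + kerOp k` (`h128_lap_torus`, from `B5SmoothPartition.h128S_torus_fibre`):
for an axis Laplacian `w` through a base map `π` with fibres `≤ m`, a RESIDUAL LOCAL kernel `l′` of range `ρ ≥ 1`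
with a normed commutator bound `ℓ′` (HYPOTHESIS — standing for whatever part of the remaining local terms
`S*(∂h)QA − Q*S(∂h)A + P₁(∂h)A` / `aQ*Q` of (1.121) a consumer keeps in the finite-range part; `l′ = 0`, `ℓ′ = 0` is
allowed) and a kernel `k` with `|k_ij| ≤ C e^{−δ dist(π i, π j)}` (HYPOTHESIS — (1.126)), the bound (1.128) holds at
rate `twoDelta0 δ M₀ = min{⅓δ, M₀⁻¹}` with the explicit constant
`((4d/M₀)√(2d) + 52d/M₀² + ℓ′)·e^{4+ρ/M₀} + (4d/M₀)·C·(24/(eδ))·m·K_d(δ/8)·e⁷` (`K_d = B4Sect5Proof.latticeConst d`)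
— of the printed order `O(M₀⁻¹)` as soon as `ℓ′` is.

THE FINE-TORUS READING (the η-dictionary of the headers of `B5Commutator128` / `B5SmoothPartition`).  On `T_η`
(spacing `η = L^{−k}`, cube `M₀/η` fine steps) one instantiates `B5SmoothPartition` with `M₀′ = M₀/η`: per fine step
`ℓ = 4dη/M₀`, `m = 52dη²/M₀²`; with `Δ^η = η⁻²Δ_w` and `‖∇^η A‖_w := η⁻¹√(dirichlet w A)`, §1 gives
`‖[h, Δ^η]A‖ = η⁻²‖[h, Δ_w]A‖ ≤ (4d√(2d)/M₀)·‖∇^η A‖_w + (52d/M₀²)·‖A‖`, UNIFORMLY in `η` — the statement that the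
Laplacian part of `K(h)` has the small factor `O(M₀⁻¹)` against `|∇A| + |A|`.

DIVERGENCES (cell DIVERGENCE.md, D-b05g5.5).  (i) `Δ_w` is a weighted graph Laplacian on a finite component set seen
through the axis interface; Bałaban's `Δ` acts on (Lie-algebra-valued) lattice 1-forms on `T_η` — componentwise such
operators are the instances `isAxisLap_prod` (v1.1), but the identification of the printed `Δ` (and of the
component index of 1-forms on `T_η`) with such an instance is not typed (no operator calculus of B5 §1 exists in the
tree: cell GAPS G-B5-30 (i) / G-B5-31 (c)).
(ii) ONLY the Laplacian summand of (1.121) is discharged; the terms `S*(∂h)QA − Q*S(∂h)A + P₁(∂h)A` (in print the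
contributions of `aQ*Q` and `−∂P∂*` to `K(h)`) stay the normed hypothesis `ℓ′` or go into the decaying kernel `k` of
(1.126) — both HYPOTHESES, as in G-B5-29.  (iii) `dirichlet` counts every unordered edge twice
for symmetric `w` (constants accordingly: `W = 2d` gives the `√(2d)`); the consumer's gradient operator `Dg` enters only
through `√(dirichlet w A) ≤ ‖Dg A‖`.  (iv) Hypothesis `2M₀ ≤ N_i` (inherited from the second-difference bound); no
divisibility is needed in this file.  (v) Sup circular distance on the torus (D-b05g5.1 (ii)); constants unoptimised.

v1.1 (same seat): ADDITIVE §3b — `axisWC`, `sum_axisWC`, `isAxisLap_prod` (the componentwise instance on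
`UT N × κ`); header §3 / DIVERGENCES (i) updated accordingly; the 22 declarations of v1 (p181334, cross-read C-ref5-87:
boundary clean) are unchanged.

HONEST LABELLING.  Nothing here is a claim of the paper beyond the two displays named; every statement is
kernel-proved; decls marked MODEL / INTERFACE / CONSTRUCTION are this library's; [folklore] marks elementary facts.
Imports: `B5Commutator128` (kernel operators, commutator identity), `B5SmoothPartition` (the partition data, the
torus corollary of the schema) and Mathlib.
value = kernel certificate of a located leaf (the Laplacian part of the local bound (1.121) ⟹ `Schema.local_norm`
with `ℓ₁ = O(M₀⁻¹)`, uniformly in the torus) — NOT summit progress.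
-/
import Mathlib
import Literature.MathematicalPhysics.QuantumFieldTheory.Balaban1983to89.B5Commutator128
import Literature.MathematicalPhysics.QuantumFieldTheory.Balaban1983to89.B5SmoothPartition

open Finset

namespace Literature.MathematicalPhysics.QuantumFieldTheory.Balaban1983to89.B5Leibniz121

open B5TorusPartition (mulOp mulOp_apply norm_mulOp_le)
open B5Commutator128 (kerOp kerOp_apply comm_mulOp_kerOp)
open B5TorusCover (UT Ctr ctrU)
open B5SmoothPartition (hS hSU HSop hSU_lipschitz abs_hS_second_diff_le fin_val_add_one_rep h128S_torus_fibre)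
open B5Local114 (Kop)
open B5Walk131 (twoDelta0)
open B4TorusKernel.MultiPeriod (circAbs circAbs_le_abs circAbs_add_mul)
open B4Sect5Torus (TSite ccoord tdist ccoord_cast)

noncomputable section

/-! ## §1  Weighted graph Laplacians as kernel operators; the lattice Leibniz rule for `[h, Δ_w]` -/

section Laplacian

variable {ι : Type} [Fintype ι] [DecidableEq ι]

/-- The weighted graph Laplacian KERNEL of a weight `w : ι → ι → ℝ`: off the diagonal `w i j`, on the diagonal
corrected by the row sum so that every row sums to zero; `kerOp (lapKer w)` is the operator
`(Δ_w A)_i = Σ_j w_ij (A_j − A_i)` (`lap_apply`). [folklore] -/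
def lapKer (w : ι → ι → ℝ) (i j : ι) : ℝ := w i j - if i = j then ∑ j', w i j' else 0

/-- `(Δ_w A)_i = Σ_j w_ij (A_j − A_i)`. [folklore] -/
theorem lap_apply (w : ι → ι → ℝ) (A : EuclideanSpace ℝ ι) (i : ι) :
    kerOp (lapKer w) A i = ∑ j, w i j * (A j - A i) := by
  rw [kerOp_apply]
  simp only [lapKer, sub_mul, ite_mul, zero_mul, Finset.sum_sub_distrib, Finset.sum_ite_eq, Finset.mem_univ,
    if_true, mul_sub, Finset.sum_mul]

/-- **The commutator of a multiplier with a weighted Laplacian is the kernel operator `(a_i − a_j) w_ij`** (the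
diagonal correction drops out). [folklore] -/
theorem comm_lap_eq (a : ι → ℝ) (w : ι → ι → ℝ) :
    mulOp a * kerOp (lapKer w) - kerOp (lapKer w) * mulOp a = kerOp fun i j => (a i - a j) * w i j := by
  rw [comm_mulOp_kerOp]
  congr 1
  funext i j
  unfold lapKer
  split_ifs with h
  · subst h; ring
  · ring

/-- **The lattice Leibniz rule** (the `Σ_b (∂h)(b)(∂A)(b) + (Δh)A` structure of the commutator `K(h)` of
(1.121) for the Laplacian part): `([h, Δ_w]A)_i = Σ_j w_ij (h_i − h_j)(A_j − A_i) + (Σ_j w_ij (h_i − h_j))·A_i` — a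
`(∂h)(∂A)` term plus multiplication by `−(Δ_w h)_i`. [cite: Balaban1984PropagatorsI, (1.121) p.37] -/
theorem comm_lap_apply (a : ι → ℝ) (w : ι → ι → ℝ) (A : EuclideanSpace ℝ ι) (i : ι) :
    (mulOp a * kerOp (lapKer w) - kerOp (lapKer w) * mulOp a) A i
      = ∑ j, w i j * (a i - a j) * (A j - A i) + (∑ j, w i j * (a i - a j)) * A i := by
  rw [comm_lap_eq, kerOp_apply, Finset.sum_mul, ← Finset.sum_add_distrib]
  exact Finset.sum_congr rfl fun j _ => by ring

/-- The Dirichlet form of the weight `w`: `D_w(A) = Σ_i Σ_j w_ij (A_j − A_i)²` (the square of the lattice gradient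
norm `‖∇A‖²`, each unordered edge counted twice for symmetric `w`). [folklore] -/
def dirichlet (w : ι → ι → ℝ) (A : EuclideanSpace ℝ ι) : ℝ := ∑ i, ∑ j, w i j * (A j - A i) ^ 2

omit [DecidableEq ι] in
/-- `D_w(A) ≥ 0` for nonnegative weights. [folklore] -/
theorem dirichlet_nonneg {w : ι → ι → ℝ} (hw : ∀ i j, 0 ≤ w i j) (A : EuclideanSpace ℝ ι) :
    0 ≤ dirichlet w A :=
  Finset.sum_nonneg fun i _ => Finset.sum_nonneg fun j _ => mul_nonneg (hw i j) (sq_nonneg _)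

omit [DecidableEq ι] in
/-- Weighted Cauchy–Schwarz: `(Σ_j w_j x_j y_j)² ≤ (Σ_j w_j x_j²)(Σ_j w_j y_j²)` for `w ≥ 0`. [folklore] -/
theorem weighted_cauchy_schwarz {w x y : ι → ℝ} (hw : ∀ j, 0 ≤ w j) :
    (∑ j, w j * x j * y j) ^ 2 ≤ (∑ j, w j * x j ^ 2) * ∑ j, w j * y j ^ 2 := by
  have h := Finset.sum_mul_sq_le_sq_mul_sq Finset.univ (fun j => Real.sqrt (w j) * x j)
    (fun j => Real.sqrt (w j) * y j)
  have e1 : ∑ j, Real.sqrt (w j) * x j * (Real.sqrt (w j) * y j) = ∑ j, w j * x j * y j :=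
    Finset.sum_congr rfl fun j _ => by
      have := Real.mul_self_sqrt (hw j)
      linear_combination (x j * y j) * this
  have e2 : ∀ u : ι → ℝ, ∑ j, (Real.sqrt (w j) * u j) ^ 2 = ∑ j, w j * u j ^ 2 := fun u =>
    Finset.sum_congr rfl fun j _ => by rw [mul_pow, Real.sq_sqrt (hw j)]
  rw [e1, e2, e2] at h
  exact h

/-- **The Laplacian part of the local bound (1.121)/(1.128), PROVED**: if `w ≥ 0` has row sums `≤ W`, the
multiplier `a` varies by at most `ℓ` across every edge (`w_ij ≠ 0 ⇒ |a_i − a_j| ≤ ℓ` — the `∇h = O(M₀⁻¹)` datum)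
and `|(Δ_w a)_i| ≤ m` (the `Δh = O(M₀⁻²)` datum), then
`‖[a, Δ_w]A‖ ≤ ℓ√W·√(D_w(A)) + m‖A‖`. [cite: Balaban1984PropagatorsI, (1.121) p.37 with (1.128) p.38] -/
theorem norm_comm_lap_le {a : ι → ℝ} {w : ι → ι → ℝ} {ℓ W m : ℝ} (hw : ∀ i j, 0 ≤ w i j) (hℓ : 0 ≤ ℓ)
    (hlip : ∀ i j, w i j ≠ 0 → |a i - a j| ≤ ℓ) (hW0 : 0 ≤ W) (hW : ∀ i, ∑ j, w i j ≤ W) (hm0 : 0 ≤ m)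
    (hm : ∀ i, |∑ j, w i j * (a j - a i)| ≤ m) (A : EuclideanSpace ℝ ι) :
    ‖(mulOp a * kerOp (lapKer w) - kerOp (lapKer w) * mulOp a) A‖
      ≤ ℓ * Real.sqrt W * Real.sqrt (dirichlet w A) + m * ‖A‖ := by
  set b : ι → ℝ := fun i => ∑ j, w i j * (a i - a j) with hb
  set T : EuclideanSpace ℝ ι :=
    (mulOp a * kerOp (lapKer w) - kerOp (lapKer w) * mulOp a) A - mulOp b A with hT
  have hTi : ∀ i, T i = ∑ j, w i j * (a i - a j) * (A j - A i) := by
    intro i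
    rw [hT, PiLp.sub_apply, comm_lap_apply, mulOp_apply]
    ring
  have hsplit : (mulOp a * kerOp (lapKer w) - kerOp (lapKer w) * mulOp a) A = T + mulOp b A := by
    rw [hT]; abel
  -- the multiplication part
  have hbm : ∀ i, |b i| ≤ m := by
    intro i
    have : b i = -∑ j, w i j * (a j - a i) := by
      rw [hb, ← Finset.sum_neg_distrib]
      exact Finset.sum_congr rfl fun j _ => by ring
    rw [this, abs_neg]
    exact hm i
  have hmul : ‖mulOp b A‖ ≤ m * ‖A‖ := norm_mulOp_le hm0 hbm A
  -- the gradient part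
  have hrowa : ∀ i, ∑ j, w i j * (a i - a j) ^ 2 ≤ W * ℓ ^ 2 := by
    intro i
    have h1 : ∀ j, w i j * (a i - a j) ^ 2 ≤ w i j * ℓ ^ 2 := by
      intro j
      by_cases h0 : w i j = 0
      · rw [h0]; simp
      · apply mul_le_mul_of_nonneg_left _ (hw i j)
        rw [← sq_abs]
        exact pow_le_pow_left₀ (abs_nonneg _) (hlip i j h0) 2
    calc ∑ j, w i j * (a i - a j) ^ 2 ≤ ∑ j, w i j * ℓ ^ 2 := Finset.sum_le_sum fun j _ => h1 j
      _ = (∑ j, w i j) * ℓ ^ 2 := by rw [Finset.sum_mul]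
      _ ≤ W * ℓ ^ 2 := mul_le_mul_of_nonneg_right (hW i) (sq_nonneg _)
  have hTsq : ‖T‖ ^ 2 ≤ (ℓ ^ 2 * W) * dirichlet w A := by
    rw [PiLp.norm_sq_eq_of_L2]
    unfold dirichlet
    rw [Finset.mul_sum]
    apply Finset.sum_le_sum
    intro i _
    rw [Real.norm_eq_abs, sq_abs, hTi]
    calc (∑ j, w i j * (a i - a j) * (A j - A i)) ^ 2
        ≤ (∑ j, w i j * (a i - a j) ^ 2) * ∑ j, w i j * (A j - A i) ^ 2 :=
          weighted_cauchy_schwarz (w := w i) (x := fun j => a i - a j) (y := fun j => A j - A i) (hw i)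
      _ ≤ (W * ℓ ^ 2) * ∑ j, w i j * (A j - A i) ^ 2 :=
          mul_le_mul_of_nonneg_right (hrowa i)
            (Finset.sum_nonneg fun j _ => mul_nonneg (hw i j) (sq_nonneg _))
      _ = ℓ ^ 2 * W * ∑ j, w i j * (A j - A i) ^ 2 := by ring
  have hTn : ‖T‖ ≤ ℓ * Real.sqrt W * Real.sqrt (dirichlet w A) := by
    have h1 : ‖T‖ = Real.sqrt (‖T‖ ^ 2) := (Real.sqrt_sq (norm_nonneg _)).symm
    rw [h1]
    calc Real.sqrt (‖T‖ ^ 2) ≤ Real.sqrt ((ℓ ^ 2 * W) * dirichlet w A) := Real.sqrt_le_sqrt hTsq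
      _ = ℓ * Real.sqrt W * Real.sqrt (dirichlet w A) := by
          rw [Real.sqrt_mul (by positivity), Real.sqrt_mul (sq_nonneg _), Real.sqrt_sq hℓ]
  rw [hsplit]
  exact (norm_add_le _ _).trans (add_le_add hTn hmul)

/-- **The same bound in the shape of `B5Commutator128.Schema.local_norm`**: for any operator `Dg` dominating the
lattice gradient norm (`√(D_w(A)) ≤ ‖Dg A‖` — the consumer's `∇_a`), `‖[a, Δ_w]A‖ ≤ (ℓ√W + m)(‖Dg A‖ + ‖A‖)`.
[cite: Balaban1984PropagatorsI, (1.128) p.38 (the norm |∇_a A| + |A| on the right side)] -/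
theorem norm_comm_lap_le' {a : ι → ℝ} {w : ι → ι → ℝ} {ℓ W m : ℝ} (hw : ∀ i j, 0 ≤ w i j) (hℓ : 0 ≤ ℓ)
    (hlip : ∀ i j, w i j ≠ 0 → |a i - a j| ≤ ℓ) (hW0 : 0 ≤ W) (hW : ∀ i, ∑ j, w i j ≤ W) (hm0 : 0 ≤ m)
    (hm : ∀ i, |∑ j, w i j * (a j - a i)| ≤ m) {Dg : Module.End ℝ (EuclideanSpace ℝ ι)}
    (hDg : ∀ A, Real.sqrt (dirichlet w A) ≤ ‖Dg A‖) (A : EuclideanSpace ℝ ι) :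
    ‖(mulOp a * kerOp (lapKer w) - kerOp (lapKer w) * mulOp a) A‖
      ≤ (ℓ * Real.sqrt W + m) * (‖Dg A‖ + ‖A‖) := by
  have h := norm_comm_lap_le hw hℓ hlip hW0 hW hm0 hm A
  have h1 : ℓ * Real.sqrt W * Real.sqrt (dirichlet w A) ≤ ℓ * Real.sqrt W * ‖Dg A‖ :=
    mul_le_mul_of_nonneg_left (hDg A) (by positivity)
  have h2 : 0 ≤ ℓ * Real.sqrt W := by positivity
  have h3 := norm_nonneg (Dg A)
  have h4 := norm_nonneg A
  nlinarith

omit [DecidableEq ι] in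
/-- **Kernel ranges add under the commutator**: `[a, kerOp (l + l')] = [a, kerOp l] + [a, kerOp l']` (used to add
a further local kernel — e.g. the `aQ*Q`-part of `Δ_a` — to the Laplacian). [folklore] -/
theorem comm_kerOp_add (a : ι → ℝ) (l l' : ι → ι → ℝ) (A : EuclideanSpace ℝ ι) :
    (mulOp a * kerOp (fun i j => l i j + l' i j) - kerOp (fun i j => l i j + l' i j) * mulOp a) A
      = (mulOp a * kerOp l - kerOp l * mulOp a) A + (mulOp a * kerOp l' - kerOp l' * mulOp a) A := by
  rw [B5Commutator128.kerOp_add]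
  simp only [LinearMap.sub_apply, LinearMap.add_apply, Module.End.mul_apply, map_add]
  abel

end Laplacian

/-! ## §2  Axis Laplacians through a base map on the finite torus; the smooth partition gives `ℓ₁ = O(M₀⁻¹)` -/

section Torus

variable {d : ℕ} {N : Fin d → ℕ} [∀ i, NeZero (N i)]

/-- The forward neighbour `x + e_μ` on the torus carrier. [folklore] -/
def up (x : UT N) (μ : Fin d) : UT N :=
  UT.ofSite N (Function.update (UT.toSite N x) μ (UT.toSite N x μ + 1))

/-- The backward neighbour `x − e_μ` on the torus carrier. [folklore] -/
def dn (x : UT N) (μ : Fin d) : UT N :=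
  UT.ofSite N (Function.update (UT.toSite N x) μ (UT.toSite N x μ - 1))

variable {ι : Type} [Fintype ι] [DecidableEq ι]

/-- INTERFACE (no existence smuggled: `isAxisLap_torus` below constructs an instance).  A weight `w` on a component
index type `ι` fibred over the torus by `π` is an AXIS LAPLACIAN when it is nonnegative, supported on pairs at torus
distance `≤ 1`, has row sums `≤ 2d`, and sums every function of the base point over the `2d` axis neighbours as
`Σ_j w_ij (f(π j) − f(π i)) = Σ_μ (f(π i + e_μ) − 2f(π i) + f(π i − e_μ))` — the shape of the lattice Laplacian
`Δ = Σ_μ ∂_μ*∂_μ` acting componentwise. [folklore] -/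
structure IsAxisLap (π : ι → UT N) (w : ι → ι → ℝ) : Prop where
  /-- weights are nonnegative -/
  nonneg : ∀ i j, 0 ≤ w i j
  /-- weights live on pairs at torus distance `≤ 1` -/
  range : ∀ i j, w i j ≠ 0 → dist (π i) (π j) ≤ 1
  /-- row sums are at most `2d` -/
  rowsum : ∀ i, ∑ j, w i j ≤ 2 * d
  /-- the axis structure: `w` averages functions of the base point over the `2d` axis neighbours -/
  axis : ∀ (f : UT N → ℝ) (i : ι),
    ∑ j, w i j * (f (π j) - f (π i)) = ∑ μ, (f (up (π i) μ) - 2 * f (π i) + f (dn (π i) μ))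

/-- **Centred second differences of the smooth partition functions are `≤ 52/M₀²`** along every axis (from the
forward form `B5SmoothPartition.abs_hS_second_diff_le` based at `x − e_μ`). [cite: Balaban1984PropagatorsI, (1.121) p.37] -/
theorem abs_hSU_centred_le {M₀ : ℕ} (hM : 1 ≤ M₀) (h2N : ∀ i, 2 * M₀ ≤ N i) (z : Ctr N M₀) (x : UT N)
    (μ : Fin d) :
    |hSU N M₀ z (up x μ) - 2 * hSU N M₀ z x + hSU N M₀ z (dn x μ)| ≤ 52 / (M₀ : ℝ) ^ 2 := by
  set s : B4Sect5Torus.TSite d N := UT.toSite N x with hs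
  set s' : B4Sect5Torus.TSite d N := Function.update s μ (s μ - 1) with hs'
  have h1 : s' μ = s μ - 1 := by rw [hs', Function.update_self]
  have hup : UT.toSite N (up x μ) = Function.update s' μ (s' μ + 1 + 1) := by
    rw [h1, sub_add_cancel, hs', Function.update_idem]
    rfl
  have hmid : UT.toSite N x = Function.update s' μ (s' μ + 1) := by
    rw [h1, sub_add_cancel, hs', Function.update_idem, Function.update_eq_self]
  have hdn : UT.toSite N (dn x μ) = s' := rfl
  unfold hSU
  rw [hup, hdn]
  conv_lhs => rw [hmid]
  exact abs_hS_second_diff_le hM h2N z s' μ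

/-- **THE LAPLACIAN PART OF (1.121) FOR THE SMOOTH PARTITION, PROVED**: for an axis Laplacian `w` through `π` and
the multipliers `hS_z ∘ π`, `‖[hS_z, Δ_w]A‖ ≤ (4d/M₀)·√(2d)·√(D_w(A)) + (52d/M₀²)·‖A‖` — the printed
`O(M₀⁻¹)(|∇A| + |A|)` with explicit constants, for every torus with `2M₀ ≤ N_i` (no divisibility hypothesis).
[cite: Balaban1984PropagatorsI, (1.121) p.37 with (1.128) p.38] -/
theorem norm_comm_lap_hS_le {M₀ : ℕ} (hM : 1 ≤ M₀) (h2N : ∀ i, 2 * M₀ ≤ N i) {π : ι → UT N}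
    {w : ι → ι → ℝ} (hw : IsAxisLap π w) (z : Ctr N M₀) (A : EuclideanSpace ℝ ι) :
    ‖(HSop N M₀ π z * kerOp (lapKer w) - kerOp (lapKer w) * HSop N M₀ π z) A‖
      ≤ 4 * d / M₀ * Real.sqrt (2 * d) * Real.sqrt (dirichlet w A) + 52 * d / (M₀ : ℝ) ^ 2 * ‖A‖ := by
  have hM0 : (0 : ℝ) < M₀ := by exact_mod_cast hM
  have hlip : ∀ i j, w i j ≠ 0 → |hSU N M₀ z (π i) - hSU N M₀ z (π j)| ≤ 4 * d / M₀ := by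
    intro i j hij
    calc |hSU N M₀ z (π i) - hSU N M₀ z (π j)| ≤ 4 * d / M₀ * dist (π i) (π j) := hSU_lipschitz N hM z _ _
      _ ≤ 4 * d / M₀ * 1 := mul_le_mul_of_nonneg_left (hw.range i j hij) (by positivity)
      _ = 4 * d / M₀ := mul_one _
  have hm : ∀ i, |∑ j, w i j * (hSU N M₀ z (π j) - hSU N M₀ z (π i))| ≤ 52 * d / (M₀ : ℝ) ^ 2 := by
    intro i
    rw [hw.axis (hSU N M₀ z) i]
    calc |∑ μ, (hSU N M₀ z (up (π i) μ) - 2 * hSU N M₀ z (π i) + hSU N M₀ z (dn (π i) μ))|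
        ≤ ∑ μ, |hSU N M₀ z (up (π i) μ) - 2 * hSU N M₀ z (π i) + hSU N M₀ z (dn (π i) μ)| :=
          Finset.abs_sum_le_sum_abs _ _
      _ ≤ ∑ _μ : Fin d, 52 / (M₀ : ℝ) ^ 2 :=
          Finset.sum_le_sum fun μ _ => abs_hSU_centred_le hM h2N z (π i) μ
      _ = 52 * d / (M₀ : ℝ) ^ 2 := by
          rw [Finset.sum_const, Finset.card_univ, Fintype.card_fin, nsmul_eq_mul]; ring
  unfold HSop
  exact norm_comm_lap_le hw.nonneg (by positivity) hlip (by positivity) hw.rowsum (by positivity) hm A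

/-- **The field `Schema.local_norm` of `B5Commutator128` for `l := lapKer w`, DISCHARGED** with
`ℓ₁ := (4d/M₀)√(2d) + 52d/M₀²` (`= O(M₀⁻¹)`), given any `Dg` dominating the lattice gradient norm of `w`.
[cite: Balaban1984PropagatorsI, (1.121) p.37 with (1.128) p.38] -/
theorem local_norm_lap_hS {M₀ : ℕ} (hM : 1 ≤ M₀) (h2N : ∀ i, 2 * M₀ ≤ N i) {π : ι → UT N}
    {w : ι → ι → ℝ} (hw : IsAxisLap π w) {Dg : Module.End ℝ (EuclideanSpace ℝ ι)}
    (hDg : ∀ A, Real.sqrt (dirichlet w A) ≤ ‖Dg A‖) (z : Ctr N M₀) (A : EuclideanSpace ℝ ι) :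
    ‖(HSop N M₀ π z * kerOp (lapKer w) - kerOp (lapKer w) * HSop N M₀ π z) A‖
      ≤ (4 * d / M₀ * Real.sqrt (2 * d) + 52 * d / (M₀ : ℝ) ^ 2) * (‖Dg A‖ + ‖A‖) := by
  have h := norm_comm_lap_hS_le hM h2N hw z A
  have h1 : 4 * d / M₀ * Real.sqrt (2 * d) * Real.sqrt (dirichlet w A)
      ≤ 4 * d / M₀ * Real.sqrt (2 * d) * ‖Dg A‖ :=
    mul_le_mul_of_nonneg_left (hDg A) (by positivity)
  have h2 : (0 : ℝ) ≤ 4 * d / M₀ * Real.sqrt (2 * d) := by positivity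
  have h3 : (0 : ℝ) ≤ 52 * d / (M₀ : ℝ) ^ 2 := by positivity
  have h4 := norm_nonneg (Dg A)
  have h5 := norm_nonneg A
  nlinarith

end Torus

/-! ## §3  CONSTRUCTION: the scalar axis Laplacian of the torus is an `IsAxisLap` instance -/

section Construction

variable {d : ℕ} {N : Fin d → ℕ} [∀ i, NeZero (N i)]

/-- `x = (x − e_μ) + e_μ`. [folklore] -/
theorem up_dn (x : UT N) (μ : Fin d) : up (dn x μ) μ = x := by
  unfold up dn
  have h1 : UT.toSite N (UT.ofSite N (Function.update (UT.toSite N x) μ (UT.toSite N x μ - 1))) μ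
      = UT.toSite N x μ - 1 := by
    show Function.update (UT.toSite N x) μ (UT.toSite N x μ - 1) μ = _
    rw [Function.update_self]
  rw [h1, sub_add_cancel]
  show UT.ofSite N (Function.update (Function.update (UT.toSite N x) μ (UT.toSite N x μ - 1)) μ
    (UT.toSite N x μ)) = x
  rw [Function.update_idem, Function.update_eq_self]
  rfl

/-- `dist(x, x + e_μ) ≤ 1` in the sup torus distance. [folklore] -/
theorem dist_up_le (x : UT N) (μ : Fin d) : dist x (up x μ) ≤ 1 := by
  have hN : ∀ i, 1 ≤ N i := UT.one_le N
  rw [UT.dist_eq]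
  unfold up tdist
  rw [UT.toSite_ofSite]
  have hsup : (Finset.univ.sup
      (ccoord N (UT.toSite N x) (Function.update (UT.toSite N x) μ (UT.toSite N x μ + 1))) : ℕ) ≤ 1 := by
    apply Finset.sup_le
    intro i _
    have hc := ccoord_cast hN (UT.toSite N x) (Function.update (UT.toSite N x) μ (UT.toSite N x μ + 1)) i
    suffices h : ((ccoord N (UT.toSite N x) (Function.update (UT.toSite N x) μ (UT.toSite N x μ + 1)) i : ℕ)
        : ℤ) ≤ 1 by exact_mod_cast h
    rw [hc]
    by_cases hi : i = μ
    · subst hi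
      rw [Function.update_self]
      obtain ⟨m, hm⟩ := fin_val_add_one_rep (UT.toSite N x i)
      rw [hm, show ((UT.toSite N x i).val : ℤ) - (((UT.toSite N x i).val : ℤ) + 1 + (N i : ℤ) * m)
          = -1 + (N i : ℤ) * (-m) by ring, circAbs_add_mul]
      have := circAbs_le_abs (hN i) (-1 : ℤ)
      simpa using this
    · rw [Function.update_of_ne hi, sub_self]
      have h0 := circAbs_le_abs (hN i) (0 : ℤ)
      have h0' : circAbs (N i) 0 ≤ 0 := by simpa using h0
      linarith
  exact_mod_cast hsup

/-- `dist(x, x − e_μ) ≤ 1`. [folklore] -/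
theorem dist_dn_le (x : UT N) (μ : Fin d) : dist x (dn x μ) ≤ 1 := by
  have h := dist_up_le (dn x μ) μ
  rw [up_dn] at h
  rwa [dist_comm] at h

/-- MODEL. The scalar axis-Laplacian weight of the torus: `w x y = #{μ : y = x + e_μ} + #{μ : y = x − e_μ}`.
[folklore] -/
def axisW (x y : UT N) : ℝ := ∑ μ : Fin d, ((if y = up x μ then 1 else 0) + (if y = dn x μ then 1 else 0))

/-- **CONSTRUCTION**: the scalar axis Laplacian of the torus (`ι := UT N`, `π := id`) is an `IsAxisLap` instance —
the interface of §2 is inhabited. [folklore] -/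
theorem isAxisLap_torus : IsAxisLap (N := N) (fun x : UT N => x) axisW where
  nonneg x y := Finset.sum_nonneg fun μ _ => by positivity
  range x y hxy := by
    by_contra hfar
    apply hxy
    apply Finset.sum_eq_zero
    intro μ _
    have h1 : y ≠ up x μ := fun h => hfar (by rw [h]; exact dist_up_le x μ)
    have h2 : y ≠ dn x μ := fun h => hfar (by rw [h]; exact dist_dn_le x μ)
    rw [if_neg h1, if_neg h2, add_zero]
  rowsum x := by
    unfold axisW
    rw [Finset.sum_comm]
    have h : ∀ μ : Fin d, ∑ y : UT N, ((if y = up x μ then (1 : ℝ) else 0) + (if y = dn x μ then 1 else 0)) = 2 :=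
      fun μ => by
        rw [Finset.sum_add_distrib, Finset.sum_ite_eq' Finset.univ (up x μ), Finset.sum_ite_eq' Finset.univ (dn x μ)]
        simp; norm_num
    rw [Finset.sum_congr rfl fun μ _ => h μ, Finset.sum_const, Finset.card_univ, Fintype.card_fin, nsmul_eq_mul]
    linarith
  axis f x := by
    unfold axisW
    simp_rw [Finset.sum_mul]
    rw [Finset.sum_comm]
    refine Finset.sum_congr rfl fun μ _ => ?_
    rw [Finset.sum_congr rfl fun y _ => add_mul _ _ (f y - f x), Finset.sum_add_distrib]
    simp_rw [ite_mul, zero_mul, one_mul]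
    rw [Finset.sum_ite_eq' Finset.univ (up x μ), Finset.sum_ite_eq' Finset.univ (dn x μ)]
    simp only [Finset.mem_univ, if_true]
    ring

end Construction

/-! ### §3b  CONSTRUCTION: componentwise axis Laplacians on vector-valued fields -/

section Componentwise

variable {d : ℕ} {N : Fin d → ℕ} [∀ i, NeZero (N i)] {κ : Type} [Fintype κ] [DecidableEq κ]

/-- MODEL. The componentwise axis weight on `UT N × κ` (a field with components indexed by `κ` at every torus
point): `axisW` between equal components, `0` between different ones. [folklore] -/
def axisWC (p q : UT N × κ) : ℝ := if p.2 = q.2 then axisW p.1 q.1 else 0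

/-- Rows of `axisWC` reduce to rows of `axisW` after summing out the component index. [folklore] -/
theorem sum_axisWC (p : UT N × κ) (g : UT N → ℝ) :
    ∑ q : UT N × κ, axisWC p q * g q.1 = ∑ y : UT N, axisW p.1 y * g y := by
  rw [Fintype.sum_prod_type]
  refine Finset.sum_congr rfl fun y _ => ?_
  unfold axisWC
  simp only [ite_mul, zero_mul]
  rw [Finset.sum_ite_eq Finset.univ p.2]
  simp

/-- **CONSTRUCTION (vector-valued fields)**: the componentwise axis Laplacian on `ι := UT N × κ` with base map
`Prod.fst` is an `IsAxisLap` instance — the shape of `Δ = Σ_μ ∂_μ*∂_μ` acting on each of finitely many components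
(`κ = Fin d × 𝔤`-coordinates of a Lie-algebra-valued 1-form, say). [folklore] -/
theorem isAxisLap_prod : IsAxisLap (N := N) (fun p : UT N × κ => p.1) axisWC where
  nonneg p q := by
    unfold axisWC
    split_ifs
    · exact isAxisLap_torus.nonneg p.1 q.1
    · exact le_rfl
  range p q hpq := by
    unfold axisWC at hpq
    split_ifs at hpq with h
    · exact isAxisLap_torus.range p.1 q.1 hpq
    · exact absurd rfl hpq
  rowsum p := by
    have h := sum_axisWC p fun _ => 1
    simp only [mul_one] at h
    rw [h]
    exact isAxisLap_torus.rowsum p.1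
  axis f p := by
    rw [sum_axisWC p fun y => f y - f p.1]
    exact isAxisLap_torus.axis f p.1

end Componentwise

/-! ## §4  (1.128) for `Δ_model = Δ_w + (local kernel) + (decaying kernel)` with the smooth partition, all
constants explicit except the residual local kernel's -/

section Assembly

variable {d : ℕ} {N : Fin d → ℕ} [∀ i, NeZero (N i)] {ι : Type} [Fintype ι] [DecidableEq ι]

/-- **(1.128) FOR THE MODEL OPERATOR `Δ_w + kerOp l' + kerOp k` AND THE SMOOTH PARTITION**: an axis Laplacian
`w` through a base map `π` with fibres `≤ m`, a further LOCAL kernel `l'` of range `ρ ≥ 1` whose commutator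
with `hS_z` obeys a normed bound `ℓ'` (HYPOTHESIS — in print the `aQ*Q`/`S(∂h)` terms of (1.121)), and a kernel
`k` with the decay (1.126) (HYPOTHESIS): then the bound (1.128) holds with rate `twoDelta0 δ M₀` and the explicit
constant `((4d/M₀)√(2d) + 52d/M₀² + ℓ')·e^{4+ρ/M₀} + (4d/M₀)·C·(24/(eδ))·m·K_d(δ/8)·e⁷`, for every torus with
`2M₀ ≤ N_i` and any `Dg` dominating the lattice gradient norm of `w`.
[cite: Balaban1984PropagatorsI, (1.128) p.38 with (1.121) p.37, (1.126) p.38] -/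
theorem h128_lap_torus {M₀ : ℕ} (hM : 1 ≤ M₀) (h2N : ∀ i, 2 * M₀ ≤ N i) (π : ι → UT N) {m : ℕ}
    (hm : ∀ y : UT N, ((Finset.univ.filter fun j : ι => π j = y).card : ℝ) ≤ m)
    {w : ι → ι → ℝ} (hw : IsAxisLap π w) {Dg : Module.End ℝ (EuclideanSpace ℝ ι)}
    (hDg : ∀ A, Real.sqrt (dirichlet w A) ≤ ‖Dg A‖)
    {l' k : ι → ι → ℝ} {ℓ' ρ C δ : ℝ} (hρ : 1 ≤ ρ) (range' : ∀ i j, ρ < dist (π i) (π j) → l' i j = 0)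
    (local' : ∀ z A, ‖(HSop N M₀ π z * kerOp l' - kerOp l' * HSop N M₀ π z) A‖ ≤ ℓ' * (‖Dg A‖ + ‖A‖))
    (hℓ' : 0 ≤ ℓ') (decay : ∀ i j, |k i j| ≤ C * Real.exp (-(δ * dist (π i) (π j)))) (hC : 0 ≤ C)
    (hδ : 0 < δ) (z₁ z₂ : Ctr N M₀) (A : EuclideanSpace ℝ ι) :
    ‖HSop N M₀ π z₁ (Kop (kerOp (fun i j => lapKer w i j + l' i j) + kerOp k) (HSop N M₀ π) z₂ A)‖
      ≤ (((4 * d / M₀ * Real.sqrt (2 * d) + 52 * d / (M₀ : ℝ) ^ 2) + ℓ') * Real.exp (4 + ρ / M₀)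
          + 4 * d / M₀ * C * (24 / (Real.exp 1 * δ)) * (m * B4Sect5Proof.latticeConst d (δ / 8))
            * Real.exp 7)
        * Real.exp (-(twoDelta0 δ M₀ * dist (ctrU N M₀ z₁) (ctrU N M₀ z₂))) * (‖Dg A‖ + ‖A‖) := by
  have range : ∀ i j, ρ < dist (π i) (π j) → lapKer w i j + l' i j = 0 := by
    intro i j hij
    have hne : i ≠ j := by
      rintro rfl
      rw [dist_self] at hij
      linarith
    have hw0 : w i j = 0 := by
      by_contra h
      have := hw.range i j h
      linarith
    rw [range' i j hij, add_zero]
    unfold lapKer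
    rw [if_neg hne, hw0, sub_zero]
  have local_norm : ∀ z A, ‖(HSop N M₀ π z * kerOp (fun i j => lapKer w i j + l' i j)
      - kerOp (fun i j => lapKer w i j + l' i j) * HSop N M₀ π z) A‖
        ≤ ((4 * d / M₀ * Real.sqrt (2 * d) + 52 * d / (M₀ : ℝ) ^ 2) + ℓ') * (‖Dg A‖ + ‖A‖) := by
    intro z A
    have h1 := local_norm_lap_hS hM h2N hw hDg z A
    have h2 := local' z A
    unfold HSop at h1 h2 ⊢
    rw [comm_kerOp_add, add_mul]
    exact (norm_add_le _ _).trans (add_le_add h1 h2)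
  exact h128S_torus_fibre hM π hm range local_norm (by positivity) decay hC hδ z₁ z₂ A

end Assembly

end

end Literature.MathematicalPhysics.QuantumFieldTheory.Balaban1983to89.B5Leibniz121
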